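import Mathlib
import Summits.Ventures.PercRepro2.CoinKSureGateBottom
import Summits.Ventures.PercRepro2.CoinChainMixLsm
import Summits.Ventures.PercRepro2.CoinChainWorld1

/-!
# The chained OR-vertex reduced to the two bottom bounds
(blind cell PercRepro2, night-2 g16; proofs/NIGHT2-DARC.md §56.16)

For the κ-integrated pair `G = ν·chainMix ent ent' ρ c d` (the `R`-law), `G' = ν·chainMix ent ent' ρ c d'`
(the gate) of a chained OR-vertex, with the entry set `ent` (the entries of the free-arc vertex
inside the core), the gate is log-supermodular (`mixture_lsm`) and Holley-above the `R`-law from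
every cluster meeting `ent` (`chain_cross_holley`); the clean-state theorem with bottom bounds
(`gate_functional_nonneg_of_bottom`) therefore gives the row's functional as soon as the gate's
means of the two markers on the clusters missing `ent` are at most the global `R`-means.  Those
two bounds fail in about 1 % of exact random instances (always at large `ρ`, one marker at a time)
while the functional stays nonnegative — they are the whole of what separates the chain from the
existing machinery.
-/

namespace Summit.Ventures.PercRepro2.Coin

open Classical

section ChainBottom

variable {V : Type*} [DecidableEq V] {R : Type*} [Field R] [LinearOrder R] [IsStrictOrderedRing R]

omit [LinearOrder R] [IsStrictOrderedRing R] in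
/-- On the clusters meeting `ent` the mixture is `d` (for every `ρ`). -/
lemma chainMix_of_meet_ent (ent ent' : Finset V) (ρ : R) (c d : Finset V → R) {W : Finset V}
    (h : ∃ r ∈ ent, r ∈ W) : chainMix ent ent' ρ c d W = d W := by
  unfold chainMix chainTheta
  simp [h]

/-- **THE CHAIN REDUCED TO THE TWO BOTTOM BOUNDS.** For the κ-integrated pair
`G = ν·chainMix ent ent' ρ c d` (the `R`-law), `G' = ν·chainMix ent ent' ρ c d'` (the gate) of a
chained OR-vertex (§56), with the entry set `ent` of the free-arc vertex inside the core, every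
hypothesis of the clean-state theorem holds (`mixture_lsm`, `chain_cross_holley`) — so the cleared
functional is nonnegative as soon as the gate's means of `x` and `y` on the clusters missing `ent`
are at most the global `R`-means (`hbx`, `hby`).  The two bounds are the whole of what separates
the chain from the existing machinery (§56.16). -/
theorem chain_functional_nonneg_of_bottom (U ent ent' : Finset V) (ν c d d' : Finset V → R)
    (ρ : R) (hρ0 : 0 ≤ ρ) (hρ1 : ρ ≤ 1) (hν0 : ∀ W, 0 ≤ ν W)
    (hν : ∀ s ⊆ U, ∀ t ⊆ U, ν s * ν t ≤ ν (s ∩ t) * ν (s ∪ t))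
    (hc0 : ∀ W, 0 ≤ c W) (hd0 : ∀ W, 0 ≤ d W) (hd'0 : ∀ W, 0 ≤ d' W)
    (hdc : ∀ W, d W ≤ c W) (hd'c : ∀ W, d' W ≤ c W)
    (hcc : ∀ s t, c s * c t ≤ c (s ∩ t) * c (s ∪ t))
    (hd'd' : ∀ s t, d' s * d' t ≤ d' (s ∩ t) * d' (s ∪ t))
    (hcd' : ∀ s t, c s * d' t ≤ c (s ∩ t) * d' (s ∪ t))
    (hdd' : ∀ s t, d s * d' t ≤ d (s ∩ t) * d' (s ∪ t))
    (hratio' : ∀ s t, s ⊆ t → d' s * c t ≤ c s * d' t) (m₁ m₂ : V)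
    (hbx : (∑ W ∈ U.powerset.filter (fun W => W ∩ ent = ∅),
        ν W * chainMix ent ent' ρ c d' W * (if m₁ ∈ W then (1 : R) else 0)) *
        (∑ W ∈ U.powerset, ν W * chainMix ent ent' ρ c d W) ≤
      (∑ W ∈ U.powerset.filter (fun W => W ∩ ent = ∅), ν W * chainMix ent ent' ρ c d' W) *
        (∑ W ∈ U.powerset, ν W * chainMix ent ent' ρ c d W * (if m₁ ∈ W then (1 : R) else 0)))
    (hby : (∑ W ∈ U.powerset.filter (fun W => W ∩ ent = ∅),
        ν W * chainMix ent ent' ρ c d' W * (if m₂ ∈ W then (1 : R) else 0)) *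
        (∑ W ∈ U.powerset, ν W * chainMix ent ent' ρ c d W) ≤
      (∑ W ∈ U.powerset.filter (fun W => W ∩ ent = ∅), ν W * chainMix ent ent' ρ c d' W) *
        (∑ W ∈ U.powerset, ν W * chainMix ent ent' ρ c d W * (if m₂ ∈ W then (1 : R) else 0))) :
    0 ≤ (∑ W ∈ U.powerset, ν W * chainMix ent ent' ρ c d W) ^ 2 *
          (∑ W ∈ U.powerset, ν W * chainMix ent ent' ρ c d' W *
            ((if m₁ ∈ W then (1 : R) else 0) * (if m₂ ∈ W then (1 : R) else 0)))
        - (∑ W ∈ U.powerset, ν W * chainMix ent ent' ρ c d W) *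
          (∑ W ∈ U.powerset, ν W * chainMix ent ent' ρ c d W * (if m₁ ∈ W then (1 : R) else 0)) *
          (∑ W ∈ U.powerset, ν W * chainMix ent ent' ρ c d' W * (if m₂ ∈ W then (1 : R) else 0))
        - (∑ W ∈ U.powerset, ν W * chainMix ent ent' ρ c d W) *
          (∑ W ∈ U.powerset, ν W * chainMix ent ent' ρ c d W * (if m₂ ∈ W then (1 : R) else 0)) *
          (∑ W ∈ U.powerset, ν W * chainMix ent ent' ρ c d' W * (if m₁ ∈ W then (1 : R) else 0))
        + (∑ W ∈ U.powerset, ν W * chainMix ent ent' ρ c d W * (if m₁ ∈ W then (1 : R) else 0)) *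
          (∑ W ∈ U.powerset, ν W * chainMix ent ent' ρ c d W * (if m₂ ∈ W then (1 : R) else 0)) *
          (∑ W ∈ U.powerset, ν W * chainMix ent ent' ρ c d' W) := by
  set G : Finset V → R := fun W => ν W * chainMix ent ent' ρ c d W with hGdef
  set G' : Finset V → R := fun W => ν W * chainMix ent ent' ρ c d' W with hG'def
  have hm0 : ∀ W, 0 ≤ chainMix ent ent' ρ c d W := chainMix_nonneg ent ent' hρ0 hρ1 hc0 hd0
  have hm'0 : ∀ W, 0 ≤ chainMix ent ent' ρ c d' W := chainMix_nonneg ent ent' hρ0 hρ1 hc0 hd'0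
  have hG0 : ∀ W, 0 ≤ G W := fun W => mul_nonneg (hν0 W) (hm0 W)
  have hG'0 : ∀ W, 0 ≤ G' W := fun W => mul_nonneg (hν0 W) (hm'0 W)
  have hmix' := mixture_lsm ent ent' ρ hρ0 hρ1 c d' hc0 hd'0 hd'c hcc hd'd' hcd' hratio'
  have wMM : ∀ s ⊆ U, ∀ t ⊆ U, G' s * G' t ≤ G' (s ∩ t) * G' (s ∪ t) := by
    intro s hs t ht
    simp only [hG'def]
    calc ν s * chainMix ent ent' ρ c d' s * (ν t * chainMix ent ent' ρ c d' t)
        = (ν s * ν t) * (chainMix ent ent' ρ c d' s * chainMix ent ent' ρ c d' t) := by ring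
      _ ≤ (ν (s ∩ t) * ν (s ∪ t)) *
            (chainMix ent ent' ρ c d' (s ∩ t) * chainMix ent ent' ρ c d' (s ∪ t)) :=
          mul_le_mul (hν s hs t ht) (hmix' s t) (mul_nonneg (hm'0 _) (hm'0 _))
            (mul_nonneg (hν0 _) (hν0 _))
      _ = _ := by ring
  have wML : ∀ s ⊆ U, ∀ t ⊆ U, (∃ r ∈ ent, r ∈ s) → G' s * G t ≤ G (s ∩ t) * G' (s ∪ t) := by
    intro s hs t ht hse
    have hsu : ∃ r ∈ ent, r ∈ s ∪ t := by
      obtain ⟨r, hr, hrs⟩ := hse; exact ⟨r, hr, Finset.mem_union_left _ hrs⟩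
    simp only [hGdef, hG'def]
    rw [chainMix_of_meet_ent ent ent' ρ c d' hse, chainMix_of_meet_ent ent ent' ρ c d' hsu]
    calc ν s * d' s * (ν t * chainMix ent ent' ρ c d t)
        = (ν s * ν t) * (d' s * chainMix ent ent' ρ c d t) := by ring
      _ ≤ (ν (s ∩ t) * ν (s ∪ t)) * (chainMix ent ent' ρ c d (s ∩ t) * d' (s ∪ t)) :=
          mul_le_mul (hν s hs t ht)
            (chain_cross_holley ent ent' ρ hρ0 hρ1 c d d' hdc hcd' hdd' hd'0 s t)
            (mul_nonneg (hd'0 _) (hm0 _)) (mul_nonneg (hν0 _) (hν0 _))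
      _ = _ := by ring
  have hx0 : ∀ W : Finset V, (0 : R) ≤ (if m₁ ∈ W then (1 : R) else 0) := by
    intro W; split_ifs <;> norm_num
  have hy0 : ∀ W : Finset V, (0 : R) ≤ (if m₂ ∈ W then (1 : R) else 0) := by
    intro W; split_ifs <;> norm_num
  have hxm : ∀ s t : Finset V,
      (if m₁ ∈ s then (1 : R) else 0) ≤ (if m₁ ∈ s ∪ t then (1 : R) else 0) := by
    intro s t
    by_cases h : m₁ ∈ s
    · rw [if_pos h, if_pos (Finset.mem_union_left t h)]
    · rw [if_neg h]; split_ifs <;> norm_num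
  have hym : ∀ s t : Finset V,
      (if m₂ ∈ s then (1 : R) else 0) ≤ (if m₂ ∈ s ∪ t then (1 : R) else 0) := by
    intro s t
    by_cases h : m₂ ∈ s
    · rw [if_pos h, if_pos (Finset.mem_union_left t h)]
    · rw [if_neg h]; split_ifs <;> norm_num
  exact gate_functional_nonneg_of_bottom U ent G G' (fun W => if m₁ ∈ W then (1 : R) else 0)
    (fun W => if m₂ ∈ W then (1 : R) else 0) hG0 hG'0 hx0 hy0 hxm hym wMM wML hbx hby

end ChainBottom

end Summit.Ventures.PercRepro2.Coin
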